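import Mathlib.Analysis.Calculus.MeanValue
import Mathlib.Algebra.Order.Chebyshev
import Literature.MathematicalPhysics.KineticTheory.HardSphereCanonicalTorus
import Literature.Analysis.FluidPDE.HardSphereDynamicsProofs
import HarnessLib

/-!
# Mean displacement bound along a good hard-sphere orbit on `𝕋³` (`stub_meanDisplacement`,
# stub A of the crux line `lipschitz-clock-free-past-cap`, `JParityClosure.DensityCap`,
# stmt-AtomisticToContinuum-13082)

The trajectory half of the "Lipschitz clock" of the line. Along the orbit of a good point of a
hard-sphere flow on `𝕋³` (any diameter `ε`, any number of particles `n`, all real times) the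
MEAN minimal-image displacement of the `n` particles between times `s` and `s'` is at most
`√(2K/n) · |s' − s|`, `K = configEnergy z` (`√(2K/n)` is the quadratic-mean speed, conserved
along the orbit). For `n = 0` both sides vanish (`(0 : ℝ)⁻¹ = 0`).

Proof. For `s ≤ s'` put `f τ := n⁻¹ ∑ᵢ d(xᵢ(τ), xᵢ(s))` (continuous: positions are continuous
along a hard-sphere trajectory and the minimal-image distance is jointly continuous) and
`B τ := V (τ − s)`, `V := √(2K/n)`. At every time `τ` there is a collision-free interval
`(τ, u)` (`IsHardSphereTrajectory.exists_Ioo_right_free`) on which the orbit is free flight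
from `γ τ` (`eq_freeFlight_of_Ioo_free`), so for `τ' ∈ (τ, u)`:
`f τ' − f τ ≤ n⁻¹ ∑ᵢ d(xᵢ(τ'), xᵢ(τ)) ≤ (τ' − τ) n⁻¹ ∑ᵢ ‖vᵢ(τ)‖ ≤ (τ' − τ) V`
(triangle inequality, translations are `1`-Lipschitz for the minimal-image distance,
Cauchy–Schwarz, conservation of the kinetic energy). Hence every right slope of `f` is `≤ V`
and the fencing lemma `image_le_of_liminf_slope_right_le_deriv_boundary` gives `f ≤ B` on
`[s, s']`. The case `s' < s` follows by symmetry of the distance.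

References: I. Gallagher, L. Saint-Raymond, B. Texier, *From Newton to Boltzmann* (2013), §1.1
(conservation of energy), §4.1 (hard-sphere trajectories); the bound itself is elementary.
-/

noncomputable section

namespace Summit.AtomisticToContinuum.HydrodynamicLimit.Theorems

open Set Filter Topology
open scoped BigOperators
open Literature.MathematicalPhysics.KineticTheory Literature.Analysis.FluidPDE

/-- Cauchy–Schwarz for the mean speed of a configuration: `n⁻¹ ∑ᵢ ‖vᵢ‖ ≤ √(2 · n⁻¹ · K)` with
`K = configEnergy w = ½ ∑ᵢ ‖vᵢ‖²` (Jensen for squares,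
`sum_div_card_sq_le_sum_sq_div_card`). Both sides vanish for `n = 0`. -/
theorem meanDisp_mean_norm_le_sqrt {n : ℕ} (w : Config n (Fin 3) T3) :
    (n : ℝ)⁻¹ * ∑ i, ‖(w i).2‖ ≤ Real.sqrt (2 * ((n : ℝ)⁻¹ * configEnergy w)) := by
  have h2 : 2 * ((n : ℝ)⁻¹ * configEnergy w) = (∑ i, ‖(w i).2‖ ^ 2) / (n : ℝ) := by
    simp only [configEnergy]
    ring
  rw [h2, inv_mul_eq_div]
  refine Real.le_sqrt_of_sq_le ?_
  simpa using (sum_div_card_sq_le_sum_sq_div_card (s := (Finset.univ : Finset (Fin n)))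
    (f := fun i => ‖(w i).2‖))

/-- Free flight for time `t` moves particle `i` by at most `|t| ‖vᵢ‖` in the minimal-image
distance of `𝕋³` (`Torus.euclidDist_translate_le` with the second translation `0`). -/
theorem meanDisp_euclidDist_freeFlight_le {n : ℕ} (w : Config n (Fin 3) T3) (t : ℝ)
    (i : Fin n) :
    Torus.euclidDist ((freeFlight (Torus.geometry (Fin 3)) t w i).1) ((w i).1) ≤
      |t| * ‖(w i).2‖ := by
  have h := Torus.euclidDist_translate_le (w i).1 (w i).1 (t • (w i).2) 0
  rw [Literature.Analysis.FunctionSpaces.Torus.proj_zero, add_zero, Torus.euclidDist_self,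
    zero_add, sub_zero, norm_smul, Real.norm_eq_abs] at h
  simpa only [freeFlight_apply, Torus.geometry_translate] using h

/-- Mean displacement under free flight: `n⁻¹ ∑ᵢ d(xᵢ + t vᵢ, xᵢ) ≤ |t| · √(2 · n⁻¹ · K)`
(per-particle bound `meanDisp_euclidDist_freeFlight_le` summed, then Cauchy–Schwarz
`meanDisp_mean_norm_le_sqrt`). -/
theorem meanDisp_freeFlight_le {n : ℕ} (w : Config n (Fin 3) T3) (t : ℝ) :
    (n : ℝ)⁻¹ * ∑ i, Torus.euclidDist ((freeFlight (Torus.geometry (Fin 3)) t w i).1) ((w i).1) ≤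
      |t| * Real.sqrt (2 * ((n : ℝ)⁻¹ * configEnergy w)) := by
  calc (n : ℝ)⁻¹ * ∑ i, Torus.euclidDist ((freeFlight (Torus.geometry (Fin 3)) t w i).1) ((w i).1)
      ≤ (n : ℝ)⁻¹ * ∑ i, |t| * ‖(w i).2‖ := by
        gcongr with i _
        exact meanDisp_euclidDist_freeFlight_le w t i
    _ = |t| * ((n : ℝ)⁻¹ * ∑ i, ‖(w i).2‖) := by
        rw [← Finset.mul_sum]
        ring
    _ ≤ |t| * Real.sqrt (2 * ((n : ℝ)⁻¹ * configEnergy w)) := by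
        gcongr
        exact meanDisp_mean_norm_le_sqrt w

/-- One-sided mean displacement bound along a hard-sphere trajectory `γ` on `𝕋³`: for `s ≤ s'`,
`n⁻¹ ∑ᵢ d(xᵢ(s'), xᵢ(s)) ≤ √(2 · n⁻¹ · K(γ s)) · (s' − s)`. Fencing lemma
`image_le_of_liminf_slope_right_le_deriv_boundary` on `[s, s']` for
`f τ = n⁻¹ ∑ᵢ d(xᵢ(τ), xᵢ(s))` against `B τ = V (τ − s)`: right slopes of `f` are `≤ V` because
to the right of every time the orbit is free flight on a collision-free interval
(`exists_Ioo_right_free`, `eq_freeFlight_of_Ioo_free`), by the triangle inequality,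
`meanDisp_freeFlight_le`, and conservation of energy (`configEnergy_eq_holds`). -/
theorem meanDisp_le_of_le {ε : ℝ} {n : ℕ} {γ : ℝ → Config n (Fin 3) T3}
    (hγ : IsHardSphereTrajectory (Torus.geometry (Fin 3)) ε n γ) {s s' : ℝ} (hss' : s ≤ s') :
    (n : ℝ)⁻¹ * ∑ i, Torus.euclidDist ((γ s' i).1) ((γ s i).1) ≤
      Real.sqrt (2 * ((n : ℝ)⁻¹ * configEnergy (γ s))) * (s' - s) := by
  set V := Real.sqrt (2 * ((n : ℝ)⁻¹ * configEnergy (γ s))) with hV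
  set f : ℝ → ℝ := fun τ => (n : ℝ)⁻¹ * ∑ i, Torus.euclidDist ((γ τ i).1) ((γ s i).1) with hf
  have hfc : Continuous f := by
    refine continuous_const.mul (continuous_finsetSum _ fun i _ => ?_)
    have h2 : Continuous fun τ => ((γ τ i).1, (γ s i).1) :=
      (hγ.pos_continuous i).prodMk continuous_const
    simpa only [Function.comp_def] using Torus.continuous_euclidDist.comp h2
  have hB : ∀ x, HasDerivWithinAt (fun τ => V * (τ - s)) V (Ici x) x := fun x => by
    simpa using ((hasDerivWithinAt_id x (Ici x)).sub_const s).const_mul V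
  have key : ∀ x ∈ Ico s s', ∀ r, V < r → ∃ᶠ z in 𝓝[>] x, slope f x z < r := by
    intro x _ r hr
    obtain ⟨u, hxu, hfree⟩ := hγ.exists_Ioo_right_free x
    have hE : configEnergy (γ x) = configEnergy (γ s) :=
      IsHardSphereTrajectory.configEnergy_eq_holds hγ x s
    refine Filter.Eventually.frequently ?_
    filter_upwards [Ioo_mem_nhdsGT hxu] with z hz
    have hzx : 0 < z - x := sub_pos.2 hz.1
    have hγz : γ z = freeFlight (Torus.geometry (Fin 3)) (z - x) (γ x) :=
      hγ.eq_freeFlight_of_Ioo_free hfree ⟨hz.1.le, hz.2⟩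
    have hstep : f z - f x ≤ V * (z - x) := by
      have htri : ∀ i, Torus.euclidDist ((γ z i).1) ((γ s i).1) -
          Torus.euclidDist ((γ x i).1) ((γ s i).1) ≤ Torus.euclidDist ((γ z i).1) ((γ x i).1) :=
        fun i => by linarith [euclidDist_triangle ((γ z i).1) ((γ x i).1) ((γ s i).1)]
      calc f z - f x = (n : ℝ)⁻¹ * ∑ i, (Torus.euclidDist ((γ z i).1) ((γ s i).1) -
            Torus.euclidDist ((γ x i).1) ((γ s i).1)) := by
            simp only [hf, Finset.sum_sub_distrib, mul_sub]
        _ ≤ (n : ℝ)⁻¹ * ∑ i, Torus.euclidDist ((γ z i).1) ((γ x i).1) := by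
            gcongr with i _
            exact htri i
        _ = (n : ℝ)⁻¹ * ∑ i, Torus.euclidDist
              ((freeFlight (Torus.geometry (Fin 3)) (z - x) (γ x) i).1) ((γ x i).1) := by
            rw [hγz]
        _ ≤ |z - x| * Real.sqrt (2 * ((n : ℝ)⁻¹ * configEnergy (γ x))) :=
            meanDisp_freeFlight_le _ _
        _ = V * (z - x) := by rw [abs_of_pos hzx, hE, mul_comm]
    rw [slope_def_field]
    calc (f z - f x) / (z - x) ≤ V := by rwa [div_le_iff₀ hzx]
      _ < r := hr
  have hfa : f s ≤ V * (s - s) := by simp [hf]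
  have hBc : Continuous fun τ => V * (τ - s) := by fun_prop
  exact image_le_of_liminf_slope_right_le_deriv_boundary (f := f) (B := fun τ => V * (τ - s))
    (B' := fun _ => V) hfc.continuousOn hfa hBc.continuousOn (fun x _ => hB x) key
    (right_mem_Icc.2 hss')

/-- **Mean displacement bound** (stub A of the line `lipschitz-clock-free-past-cap`, the
trajectory half of the Lipschitz clock). Along the orbit of a good point of ANY hard-sphere
flow on `𝕋³` (any diameter `ε`, any `n`, all real times), the mean minimal-image displacement
of the particles between times `s` and `s'` is at most `√(2K/n) · |s' − s|`,
`K = configEnergy z` (`√(2K/n)` = quadratic-mean speed, conserved along the orbit: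
`IsHardSphereTrajectory.configEnergy_eq_holds` + `HardSphereFlow.flow_zero`). The case `s ≤ s'`
is `meanDisp_le_of_le` for the orbit `τ ↦ Ψ.flow τ z` (`HardSphereFlow.isTrajectory`); the case
`s' ≤ s` is the same with the two times exchanged (`Torus.euclidDist_comm`). For `n = 0` both
sides vanish. -/
theorem stub_meanDisplacement {ε : ℝ} {n : ℕ} (Ψ : HardSphereFlow (Torus.geometry (Fin 3)) ε n)
    {z : Config n (Fin 3) T3} (hz : z ∈ Ψ.good) (s s' : ℝ) :
    (n : ℝ)⁻¹ * ∑ i, Torus.euclidDist ((Ψ.flow s' z i).1) ((Ψ.flow s z i).1) ≤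
      Real.sqrt (2 * ((n : ℝ)⁻¹ * configEnergy z)) * |s' - s| := by
  have hγ : IsHardSphereTrajectory (Torus.geometry (Fin 3)) ε n fun t => Ψ.flow t z :=
    Ψ.isTrajectory z hz
  have hE : ∀ t, configEnergy (Ψ.flow t z) = configEnergy z := fun t => by
    have h := IsHardSphereTrajectory.configEnergy_eq_holds hγ t 0
    simpa [Ψ.flow_zero z hz] using h
  rcases le_total s s' with h | h
  · have hmain := meanDisp_le_of_le hγ h
    rw [hE s, ← abs_of_nonneg (sub_nonneg.2 h)] at hmain
    exact hmain
  · have hmain := meanDisp_le_of_le hγ h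
    rw [hE s'] at hmain
    calc (n : ℝ)⁻¹ * ∑ i, Torus.euclidDist ((Ψ.flow s' z i).1) ((Ψ.flow s z i).1)
        = (n : ℝ)⁻¹ * ∑ i, Torus.euclidDist ((Ψ.flow s z i).1) ((Ψ.flow s' z i).1) := by
          congr 1
          exact Finset.sum_congr rfl fun i _ => Torus.euclidDist_comm _ _
      _ ≤ Real.sqrt (2 * ((n : ℝ)⁻¹ * configEnergy z)) * (s - s') := hmain
      _ = Real.sqrt (2 * ((n : ℝ)⁻¹ * configEnergy z)) * |s' - s| := by
          rw [abs_sub_comm, abs_of_nonneg (sub_nonneg.2 h)]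

end Summit.AtomisticToContinuum.HydrodynamicLimit.Theorems

end
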